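import Mathlib
import Summits.NavierStokesRegularity.NavierStokesRegularity.Theorems.EulerZoomLiouvillePowerGaugeEulerLiouvilleHoopRadialModes

/-!
# K-HOOP (c)-analytic, part 1: first-mode tools, the slice inequality in FRAME form, the two pairing bounds
(seat ns-ezl-w2 g5; `--supports stmt-NavierStokesRegularity-19832 --as helper`; HOOP-NOTE dc156936fff7 §4)

Chart-free (functions of `(t, θ)` on one slice; the assembler instantiates `a = V_r`, `b = V_θ`, `c = V_z` along `axisPt σ t θ` in the
smooth frame `e_r(θ) = rotZ θ e₀`, `e_θ(θ) = rotZ θ e₁`, `e_z`, and `mr = ⟨DV e_θ, e_r⟩`, `mθ = ⟨DV e_θ, e_θ⟩`, `mz = ⟨DV e_θ, e_z⟩`,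
`ad = ⟨DV e_r, e_r⟩ = ∂_t a`, `β = ⟨DV e_z, e_z⟩`; then `∂_θ a = t·mr + b`, `∂_θ b = t·mθ − a`, `∂_θ c = t·mz` for ALL real `t` and
`div V = ad + mθ + β`).  Tools (parametric interval integrals; nothing geometric):
* `firstMode_energy_le` — Bessel: `π⁻¹((∫f cos)² + (∫f sin)²) ≤ ∫ f²` (`= ∫(P₁f)² ≤ ∫f²`);
* `two_mul_abs_firstMode_pair_le` — `2|π⁻¹(x y + z w)| ≤ π⁻¹(x² + z²) + π⁻¹(y² + w²)`;
* `hasDerivAt_intervalIntegral_of_continuous` — `d/dx ∫_lo^hi F x t dt = ∫ ∂ₓF` for jointly continuous `F, ∂ₓF`;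
* `continuous_parametric₂_intervalIntegral` — `(σ, t) ↦ ∫_θ F σ t θ` is continuous for jointly continuous `F`;
* `intervalIntegrable_inv_mul_of_bound`, `continuousOn_intervalIntegral_inv_mul_of_bound` — `t⁻¹ G(σ, t)` bounded on
  `[s₁, s₂] × (0, T]` with `G` jointly continuous is integrable on `[0, T]` and its `t`-integral is continuous in `σ` on `[s₁, s₂]`.
Slice level:
* `two_mul_abs_pairing_le` — `2|π⁻¹(∫f cos)(∫g cos) + π⁻¹(∫f sin)(∫g sin)| ≤ ∫f² + ∫g²` (end-disc bound: `2|∫P₁(V_r)V_z| ≤ ∫V_r² + ∫V_z²`);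
* `two_mul_abs_pairing_deriv_le` — if `∂_θ g = t·m` (`g` periodic, `0 ≤ t`): the same pairing is `≤ t(∫f² + ∫m²)`
  (cross term after the `σ`-integration by parts: `2|∫(∂_zV_r)·P₁V_z| ≤ t∫(∂_zV_r)² + t∫⟨DV e_θ, e_z⟩²`, NO `t⁻¹`);
* **`hoop_slice_le_frame`** — `∫_0^T t⁻¹∫_θ(a² − b²) ≤ ∫_0^T t∫_θ(mr² + mθ²) + E(0) − E(T) − 2∫_0^T∫_θ P₁(a t)·β`
  (`hoop_slice_le` with the `t⁻¹`-weighted Frobenius entries rewritten smoothly: `t⁻¹[(∂_θa − b)² + (∂_θb + a)²] = t(mr² + mθ²)`).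

HONEST FRAMING: calculus; nothing about the crux E (19832 OPEN) or NS regularity is proved here. [HOOP-NOTE §4; folklore]
-/

noncomputable section

open Set Filter Topology Metric Function MeasureTheory Real
open scoped Interval

set_option linter.dupNamespace false

namespace Summit.NavierStokesRegularity.NavierStokesRegularity.Theorems.PowerGaugeEulerLiouville.HoopCore

/-- **Bessel for the first azimuthal mode**: for continuous `f`, `π⁻¹((∫₀^{2π} f cos)² + (∫₀^{2π} f sin)²) ≤ ∫₀^{2π} f²`
(the left side is `∫(P₁f)²`; the difference is `∫(f − P₁f)² ≥ 0`). [folklore] -/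
theorem firstMode_energy_le {f : ℝ → ℝ} (hf : Continuous f) :
    π⁻¹ * ((∫ y in (0 : ℝ)..2 * π, f y * Real.cos y) ^ 2 + (∫ y in (0 : ℝ)..2 * π, f y * Real.sin y) ^ 2) ≤
      ∫ y in (0 : ℝ)..2 * π, f y ^ 2 := by
  have hπ : (π : ℝ) ≠ 0 := Real.pi_ne_zero
  set C := ∫ y in (0 : ℝ)..2 * π, f y * Real.cos y with hC
  set S := ∫ y in (0 : ℝ)..2 * π, f y * Real.sin y with hS
  have hPc : Continuous fun x => π⁻¹ * C * Real.cos x + π⁻¹ * S * Real.sin x := by fun_prop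
  -- `∫ (f − P₁f)² = ∫ f² − 2∫ P₁f·f + ∫ (P₁f)²`
  have h1 : IntervalIntegrable (fun x => f x ^ 2) volume 0 (2 * π) := (hf.pow 2).intervalIntegrable _ _
  have h2 : IntervalIntegrable (fun x => 2 * ((π⁻¹ * C * Real.cos x + π⁻¹ * S * Real.sin x) * f x))
      volume 0 (2 * π) := ((hPc.mul hf).const_mul 2).intervalIntegrable _ _
  have h3 : IntervalIntegrable (fun x => (π⁻¹ * C * Real.cos x + π⁻¹ * S * Real.sin x) ^ 2) volume 0 (2 * π) :=
    (hPc.pow 2).intervalIntegrable _ _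
  have hexp : ∫ x in (0 : ℝ)..2 * π, (f x - (π⁻¹ * C * Real.cos x + π⁻¹ * S * Real.sin x)) ^ 2 =
      (∫ x in (0 : ℝ)..2 * π, f x ^ 2) - 2 * (∫ x in (0 : ℝ)..2 * π,
        (π⁻¹ * C * Real.cos x + π⁻¹ * S * Real.sin x) * f x) +
        ∫ x in (0 : ℝ)..2 * π, (π⁻¹ * C * Real.cos x + π⁻¹ * S * Real.sin x) ^ 2 := by
    have hfun : (fun x => (f x - (π⁻¹ * C * Real.cos x + π⁻¹ * S * Real.sin x)) ^ 2) =
        fun x => (f x ^ 2 - 2 * ((π⁻¹ * C * Real.cos x + π⁻¹ * S * Real.sin x) * f x)) +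
          (π⁻¹ * C * Real.cos x + π⁻¹ * S * Real.sin x) ^ 2 := funext fun x => by ring
    rw [hfun, intervalIntegral.integral_add (h1.sub h2) h3, intervalIntegral.integral_sub h1 h2,
      intervalIntegral.integral_const_mul]
  rw [integral_firstMode_mul hf, integral_firstMode_sq] at hexp
  have h0 : 0 ≤ ∫ x in (0 : ℝ)..2 * π, (f x - (π⁻¹ * C * Real.cos x + π⁻¹ * S * Real.sin x)) ^ 2 :=
    intervalIntegral.integral_nonneg (by positivity) fun x _ => sq_nonneg _
  have hE : π * ((π⁻¹ * C) ^ 2 + (π⁻¹ * S) ^ 2) = π⁻¹ * (C ^ 2 + S ^ 2) := by field_simp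
  have hE' : 2 * (π⁻¹ * C * C + π⁻¹ * S * S) = 2 * (π⁻¹ * (C ^ 2 + S ^ 2)) := by ring
  linarith

/-- The first-mode pairing bound: `2|π⁻¹(x y + z w)| ≤ π⁻¹(x² + z²) + π⁻¹(y² + w²)` (Cauchy–Schwarz for the two
first-mode coefficient vectors `(x, z)`, `(y, w)`). -/
theorem two_mul_abs_firstMode_pair_le (x y z w : ℝ) :
    2 * |π⁻¹ * (x * y + z * w)| ≤ π⁻¹ * (x ^ 2 + z ^ 2) + π⁻¹ * (y ^ 2 + w ^ 2) := by
  have hπ : 0 < π⁻¹ := inv_pos.2 Real.pi_pos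
  rw [abs_mul, abs_of_pos hπ]
  have h : 2 * |x * y + z * w| ≤ (x ^ 2 + z ^ 2) + (y ^ 2 + w ^ 2) := by
    rcases le_or_gt 0 (x * y + z * w) with h0 | h0
    · rw [abs_of_nonneg h0]; nlinarith [sq_nonneg (x - y), sq_nonneg (z - w)]
    · rw [abs_of_neg h0]; nlinarith [sq_nonneg (x + y), sq_nonneg (z + w)]
  nlinarith

/-- **Differentiation under the integral sign, continuous data.**  If `F : ℝ → ℝ → ℝ` has `∂ₓF x t = F' x t` everywhere
with `uncurry F`, `uncurry F'` continuous, then `x ↦ ∫_{lo}^{hi} F x t dt` has derivative `∫_{lo}^{hi} F' x₀ t dt` at `x₀`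
(domination by the max of `|F'|` on `[x₀−1, x₀+1] × [lo, hi]`). [folklore] -/
theorem hasDerivAt_intervalIntegral_of_continuous {F F' : ℝ → ℝ → ℝ}
    (hF : ∀ x t, HasDerivAt (fun x => F x t) (F' x t) x) (hFc : Continuous (uncurry F))
    (hF'c : Continuous (uncurry F')) (lo hi x₀ : ℝ) :
    HasDerivAt (fun x => ∫ t in lo..hi, F x t) (∫ t in lo..hi, F' x₀ t) x₀ := by
  have hK : IsCompact (Icc (x₀ - 1) (x₀ + 1) ×ˢ uIcc lo hi) := isCompact_Icc.prod isCompact_uIcc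
  obtain ⟨M, hM⟩ := hK.exists_bound_of_continuousOn hF'c.continuousOn
  have key := intervalIntegral.hasDerivAt_integral_of_dominated_loc_of_deriv_le
    (μ := volume) (a := lo) (b := hi) (x₀ := x₀) (bound := fun _ => M) (F := F) (F' := F')
    (ball_mem_nhds x₀ zero_lt_one)
    (Eventually.of_forall fun x => (hFc.comp (continuous_const.prodMk continuous_id)).aestronglyMeasurable)
    ((hFc.comp (continuous_const.prodMk continuous_id)).intervalIntegrable _ _)
    ((hF'c.comp (continuous_const.prodMk continuous_id)).aestronglyMeasurable)
    (Eventually.of_forall fun t (ht : t ∈ Ι lo hi) x (hx : x ∈ ball x₀ 1) => by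
      have ht' : t ∈ uIcc lo hi := uIoc_subset_uIcc ht
      have hx' : x ∈ Icc (x₀ - 1) (x₀ + 1) := by
        have : |x - x₀| < 1 := by rw [← Real.dist_eq]; exact hx
        rw [abs_lt] at this
        exact ⟨by linarith, by linarith⟩
      exact hM (x, t) ⟨hx', ht'⟩)
    intervalIntegrable_const
    (Eventually.of_forall fun t _ x _ => hF x t)
  exact key.2

/-- A `θ`-integral of a jointly continuous function of `(σ, t, θ)` is jointly continuous in `(σ, t)`. -/
theorem continuous_parametric₂_intervalIntegral {F : ℝ → ℝ → ℝ → ℝ}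
    (hF : Continuous fun q : ℝ × ℝ × ℝ => F q.1 q.2.1 q.2.2) (lo hi : ℝ) :
    Continuous fun p : ℝ × ℝ => ∫ θ in lo..hi, F p.1 p.2 θ :=
  intervalIntegral.continuous_parametric_intervalIntegral_of_continuous' (f := fun (p : ℝ × ℝ) θ => F p.1 p.2 θ)
    (by exact hF.comp (by fun_prop : Continuous fun q : (ℝ × ℝ) × ℝ => (q.1.1, q.1.2, q.2))) _ _

/-- `t ↦ t⁻¹ G t`, with `G` continuous and `|t⁻¹ G t| ≤ M` on `(0, T]`, is interval-integrable on `[0, T]`. -/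
theorem intervalIntegrable_inv_mul_of_bound {G : ℝ → ℝ} (hG : Continuous G) {T M : ℝ} (hT : 0 ≤ T)
    (hM : ∀ t ∈ Ioc 0 T, |t⁻¹ * G t| ≤ M) :
    IntervalIntegrable (fun t => t⁻¹ * G t) volume 0 T := by
  rw [intervalIntegrable_iff_integrableOn_Ioc_of_le hT]
  refine Measure.integrableOn_of_bounded (by simp) ((measurable_inv.mul hG.measurable).aestronglyMeasurable)
    (M := M) ?_
  rw [ae_restrict_iff' measurableSet_Ioc]
  exact Eventually.of_forall fun t ht => by rw [Real.norm_eq_abs]; exact hM t ht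

/-- Continuity in the parameter of `σ ↦ ∫_0^T t⁻¹ G(σ, t) dt` on `[s₁, s₂]`, for `G` jointly continuous and `t⁻¹ G` bounded on
`[s₁, s₂] × (0, T]` (dominated convergence with a constant bound). -/
theorem continuousOn_intervalIntegral_inv_mul_of_bound {G : ℝ → ℝ → ℝ} (hG : Continuous (uncurry G))
    {s₁ s₂ T M : ℝ} (hT : 0 ≤ T) (hM : ∀ σ ∈ Icc s₁ s₂, ∀ t ∈ Ioc 0 T, |t⁻¹ * G σ t| ≤ M) :
    ContinuousOn (fun σ => ∫ t in (0 : ℝ)..T, t⁻¹ * G σ t) (Icc s₁ s₂) := by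
  intro x₀ hx₀
  have hsec : ∀ σ, Continuous fun t => G σ t := fun σ => hG.comp (continuous_const.prodMk continuous_id)
  refine intervalIntegral.continuousWithinAt_of_dominated_interval (bound := fun _ => M) ?_ ?_
    intervalIntegrable_const ?_
  · exact Eventually.of_forall fun σ => ((measurable_inv.mul (hsec σ).measurable).aestronglyMeasurable)
  · filter_upwards [self_mem_nhdsWithin] with σ hσ
    refine Eventually.of_forall fun t ht => ?_
    rw [uIoc_of_le hT] at ht
    rw [Real.norm_eq_abs]
    exact hM σ hσ t ht
  · refine Eventually.of_forall fun t _ => ?_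
    exact (continuous_const.mul (hG.comp (continuous_id.prodMk continuous_const))).continuousWithinAt

/-- **End-disc pairing bound**: for continuous `f, g` on `[0, 2π]`,
`2|π⁻¹(∫f cos)(∫g cos) + π⁻¹(∫f sin)(∫g sin)| ≤ ∫f² + ∫g²` (`= 2|∫(P₁f)·g| ≤ ∫(P₁f)² + ∫(P₁g)² ≤ ∫f² + ∫g²`). -/
theorem two_mul_abs_pairing_le {f g : ℝ → ℝ} (hf : Continuous f) (hg : Continuous g) :
    2 * |π⁻¹ * (∫ y in (0 : ℝ)..2 * π, f y * Real.cos y) * (∫ y in (0 : ℝ)..2 * π, g y * Real.cos y) +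
        π⁻¹ * (∫ y in (0 : ℝ)..2 * π, f y * Real.sin y) * (∫ y in (0 : ℝ)..2 * π, g y * Real.sin y)| ≤
      (∫ y in (0 : ℝ)..2 * π, f y ^ 2) + ∫ y in (0 : ℝ)..2 * π, g y ^ 2 := by
  have h1 := firstMode_energy_le hf
  have h2 := firstMode_energy_le hg
  have h3 := two_mul_abs_firstMode_pair_le (∫ y in (0 : ℝ)..2 * π, f y * Real.cos y)
    (∫ y in (0 : ℝ)..2 * π, g y * Real.cos y) (∫ y in (0 : ℝ)..2 * π, f y * Real.sin y)
    (∫ y in (0 : ℝ)..2 * π, g y * Real.sin y)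
  have heq : π⁻¹ * (∫ y in (0 : ℝ)..2 * π, f y * Real.cos y) * (∫ y in (0 : ℝ)..2 * π, g y * Real.cos y) +
      π⁻¹ * (∫ y in (0 : ℝ)..2 * π, f y * Real.sin y) * (∫ y in (0 : ℝ)..2 * π, g y * Real.sin y) =
      π⁻¹ * ((∫ y in (0 : ℝ)..2 * π, f y * Real.cos y) * (∫ y in (0 : ℝ)..2 * π, g y * Real.cos y) +
        (∫ y in (0 : ℝ)..2 * π, f y * Real.sin y) * (∫ y in (0 : ℝ)..2 * π, g y * Real.sin y)) := by ring
  rw [heq]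
  linarith

/-- **Cross-term pairing bound** (after the `σ`-integration by parts): for continuous `f, m`, `g` with `∂_θ g = t·m`,
`g(2π) = g(0)` and `0 ≤ t`: `2|π⁻¹(∫f cos)(∫g cos) + π⁻¹(∫f sin)(∫g sin)| ≤ t(∫f² + ∫m²)`
(the first-mode coefficients of `g` are `t` times those of `m`, rotated; then Bessel twice). -/
theorem two_mul_abs_pairing_deriv_le {f g m : ℝ → ℝ} {t : ℝ} (hf : Continuous f)
    (hg : ∀ x, HasDerivAt g (t * m x) x) (hm : Continuous m) (hgper : g (2 * π) = g 0) (ht : 0 ≤ t) :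
    2 * |π⁻¹ * (∫ y in (0 : ℝ)..2 * π, f y * Real.cos y) * (∫ y in (0 : ℝ)..2 * π, g y * Real.cos y) +
        π⁻¹ * (∫ y in (0 : ℝ)..2 * π, f y * Real.sin y) * (∫ y in (0 : ℝ)..2 * π, g y * Real.sin y)| ≤
      t * ((∫ y in (0 : ℝ)..2 * π, f y ^ 2) + ∫ y in (0 : ℝ)..2 * π, m y ^ 2) := by
  obtain ⟨hc, hs⟩ := firstMode_coeffs_deriv hg (continuous_const.mul hm) hgper
  -- the coefficients of `g` in terms of those of `m`
  have hgc : ∫ y in (0 : ℝ)..2 * π, g y * Real.cos y = -(t * ∫ y in (0 : ℝ)..2 * π, m y * Real.sin y) := by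
    rw [← intervalIntegral.integral_const_mul]
    rw [show (fun y => t * (m y * Real.sin y)) = fun y => t * m y * Real.sin y from funext fun y => by ring]
    linarith
  have hgs : ∫ y in (0 : ℝ)..2 * π, g y * Real.sin y = t * ∫ y in (0 : ℝ)..2 * π, m y * Real.cos y := by
    rw [← intervalIntegral.integral_const_mul]
    rw [show (fun y => t * (m y * Real.cos y)) = fun y => t * m y * Real.cos y from funext fun y => by ring]
    exact hc.symm
  rw [hgc, hgs]
  have h1 := firstMode_energy_le hf
  have h2 := firstMode_energy_le hm
  have h3 := two_mul_abs_firstMode_pair_le (∫ y in (0 : ℝ)..2 * π, f y * Real.sin y)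
    (∫ y in (0 : ℝ)..2 * π, m y * Real.cos y) (-(∫ y in (0 : ℝ)..2 * π, f y * Real.cos y))
    (∫ y in (0 : ℝ)..2 * π, m y * Real.sin y)
  have heq : π⁻¹ * (∫ y in (0 : ℝ)..2 * π, f y * Real.cos y) * -(t * ∫ y in (0 : ℝ)..2 * π, m y * Real.sin y) +
      π⁻¹ * (∫ y in (0 : ℝ)..2 * π, f y * Real.sin y) * (t * ∫ y in (0 : ℝ)..2 * π, m y * Real.cos y) =
      t * (π⁻¹ * ((∫ y in (0 : ℝ)..2 * π, f y * Real.sin y) * (∫ y in (0 : ℝ)..2 * π, m y * Real.cos y) +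
        -(∫ y in (0 : ℝ)..2 * π, f y * Real.cos y) * (∫ y in (0 : ℝ)..2 * π, m y * Real.sin y))) := by ring
  rw [heq, abs_mul, abs_of_nonneg ht]
  have h4 := mul_le_mul_of_nonneg_left h3 ht
  rw [neg_sq] at h4
  nlinarith [h4, h1, h2, ht]

/-- **The slice inequality in frame form.**  For jointly continuous `a b mr mθ ad β : ℝ → ℝ → ℝ` (functions of `(t, θ)`) with
`∂_θ a = t·mr + b`, `∂_θ b = t·mθ − a`, `∂_t a = ad`, `a, b` `2π`-periodic in `θ`, the frame divergence relation `ad + mθ + β = 0`,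
and the hoop integrand `t⁻¹∫_θ(a² − b²)` interval-integrable on `[0, T]` (`0 < T`):
`∫_0^T t⁻¹∫_θ(a² − b²) ≤ ∫_0^T t∫_θ(mr² + mθ²) + E(0) − E(T) − 2∫_0^T∫_θ P₁(a t)·β`,
`E(t) = π⁻¹((∫a t cos)² + (∫a t sin)²)`. [HOOP-NOTE §4] -/
theorem hoop_slice_le_frame {a b mr mθ ad β : ℝ → ℝ → ℝ} {T : ℝ} (hT : 0 < T)
    (haθ : ∀ t θ, HasDerivAt (fun θ => a t θ) (t * mr t θ + b t θ) θ)
    (hbθ : ∀ t θ, HasDerivAt (fun θ => b t θ) (t * mθ t θ - a t θ) θ)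
    (had : ∀ t θ, HasDerivAt (fun t => a t θ) (ad t θ) t)
    (hac : Continuous (uncurry a)) (hbc : Continuous (uncurry b)) (hmrc : Continuous (uncurry mr))
    (hmθc : Continuous (uncurry mθ)) (hadc : Continuous (uncurry ad)) (hβc : Continuous (uncurry β))
    (haper : ∀ t, a t (2 * π) = a t 0) (hbper : ∀ t, b t (2 * π) = b t 0)
    (hdiv : ∀ t θ, ad t θ + mθ t θ + β t θ = 0)
    (hint : IntervalIntegrable (fun t => t⁻¹ * ∫ θ in (0 : ℝ)..2 * π, (a t θ ^ 2 - b t θ ^ 2)) volume 0 T) :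
    ∫ t in (0 : ℝ)..T, t⁻¹ * ∫ θ in (0 : ℝ)..2 * π, (a t θ ^ 2 - b t θ ^ 2) ≤
      (∫ t in (0 : ℝ)..T, t * ∫ θ in (0 : ℝ)..2 * π, (mr t θ ^ 2 + mθ t θ ^ 2))
        + π⁻¹ * ((∫ y in (0 : ℝ)..2 * π, a 0 y * Real.cos y) ^ 2 + (∫ y in (0 : ℝ)..2 * π, a 0 y * Real.sin y) ^ 2)
        - π⁻¹ * ((∫ y in (0 : ℝ)..2 * π, a T y * Real.cos y) ^ 2 + (∫ y in (0 : ℝ)..2 * π, a T y * Real.sin y) ^ 2)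
        - 2 * ∫ t in (0 : ℝ)..T, ∫ θ in (0 : ℝ)..2 * π,
            (π⁻¹ * (∫ y in (0 : ℝ)..2 * π, a t y * Real.cos y) * Real.cos θ +
              π⁻¹ * (∫ y in (0 : ℝ)..2 * π, a t y * Real.sin y) * Real.sin θ) * β t θ := by
  have hac' : Continuous fun p : ℝ × ℝ => a p.1 p.2 := hac
  have hbc' : Continuous fun p : ℝ × ℝ => b p.1 p.2 := hbc
  have hmrc' : Continuous fun p : ℝ × ℝ => mr p.1 p.2 := hmrc
  have hmθc' : Continuous fun p : ℝ × ℝ => mθ p.1 p.2 := hmθc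
  have haθc : Continuous (uncurry fun t θ => t * mr t θ + b t θ) := by
    show Continuous fun p : ℝ × ℝ => p.1 * mr p.1 p.2 + b p.1 p.2; fun_prop
  have hbθc : Continuous (uncurry fun t θ => t * mθ t θ - a t θ) := by
    show Continuous fun p : ℝ × ℝ => p.1 * mθ p.1 p.2 - a p.1 p.2; fun_prop
  have hdiv' : ∀ t θ, (t * mθ t θ - a t θ) + a t θ = -(t * (ad t θ + β t θ)) := by
    intro t θ; linear_combination t * hdiv t θ
  -- the `t⁻¹`-weighted entries are smooth: `t⁻¹[(t·mr)² + (t·mθ)²] = t(mr² + mθ²)`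
  have hH : Continuous fun t => ∫ θ in (0 : ℝ)..2 * π, (mr t θ ^ 2 + mθ t θ ^ 2) :=
    intervalIntegral.continuous_parametric_intervalIntegral_of_continuous' (f := fun t θ => mr t θ ^ 2 + mθ t θ ^ 2)
      (by show Continuous fun p : ℝ × ℝ => mr p.1 p.2 ^ 2 + mθ p.1 p.2 ^ 2; fun_prop) _ _
  have hfun : (fun t : ℝ => t⁻¹ * ∫ θ in (0 : ℝ)..2 * π,
      ((t * mr t θ + b t θ - b t θ) ^ 2 + (t * mθ t θ - a t θ + a t θ) ^ 2)) =
      fun t => t * ∫ θ in (0 : ℝ)..2 * π, (mr t θ ^ 2 + mθ t θ ^ 2) := by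
    funext t
    have h1 : ∫ θ in (0 : ℝ)..2 * π, ((t * mr t θ + b t θ - b t θ) ^ 2 + (t * mθ t θ - a t θ + a t θ) ^ 2) =
        t ^ 2 * ∫ θ in (0 : ℝ)..2 * π, (mr t θ ^ 2 + mθ t θ ^ 2) := by
      rw [← intervalIntegral.integral_const_mul]
      exact intervalIntegral.integral_congr fun θ _ => by ring
    rw [h1]
    rcases eq_or_ne t 0 with h0 | h0
    · simp [h0]
    · field_simp
  have hint₂ : IntervalIntegrable (fun t : ℝ => t⁻¹ * ∫ θ in (0 : ℝ)..2 * π,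
      ((t * mr t θ + b t θ - b t θ) ^ 2 + (t * mθ t θ - a t θ + a t θ) ^ 2)) volume 0 T := by
    rw [hfun]; exact (continuous_id.mul hH).intervalIntegrable _ _
  have key := hoop_slice_le hT haθ hbθ had hac hbc haθc hbθc hadc hβc haper hbper hdiv' hint hint₂
  rw [hfun] at key
  exact key

end Summit.NavierStokesRegularity.NavierStokesRegularity.Theorems.PowerGaugeEulerLiouville.HoopCore

end
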